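import Literature.NumberTheory.Sieve.SmoothArcClasses
import Mathlib.RingTheory.Coprime.Lemmas
import HarnessLib

/-!
# CRT reindexing and Ramanujan-sum lemmas for the class-restricted local factors

Topic `Literature/NumberTheory/Sieve`; a PROVED tool file (generic finite exponential-sum algebra behind
[Harper2016, §2.2] and [MontgomeryVaughanActa1975, §5–6]) feeding the CRT factorisation and the
coprime-modulus evaluation of `classLocalFactor` / `classGcdSum` / `classLocalHc` in `SmoothArcClassesCRT`.
Notation: `L_i = lcm(k_i, m_i)`, `e(x) = exp(2πix)`, `c_q(h)` = `ramanujanSum q h`.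

* `sum_filter_modEq_crt`: for coprime `L₁, L₂` and `m_i ∣ L_i`, `t ↦ (t mod L₁, t mod L₂)` is a bijection
  `{t < L₁L₂ : t ≡ r (m₁m₂)} → {t₁ < L₁ : t₁ ≡ r (m₁)} × {t₂ < L₂ : t₂ ≡ r (m₂)}` (inverse
  `Nat.chineseRemainder`), as an identity of sums; `sum_filter_modEq_mod_of_coprime`: the case `m₁ = 1`,
  `{t < km : t ≡ r (m)} → {s < k}`, `t ↦ t mod k`, for `(k, m) = 1`;
* `fourierChar_div_mul_eq_mul`: `e(ht/(k₁k₂)) = e(hu₁t/k₁) e(hu₂t/k₂)` for `u₁k₂ ≡ 1 (k₁)`, `u₂k₁ ≡ 1 (k₂)`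
  (`exists_crt_units`: such `u_i` exist for coprime `k₁, k₂`);
* `lcm_mul_mul_eq_lcm_mul_lcm`: `lcm(k₁k₂, m₁m₂) = L₁L₂` for `(k₁m₁, k₂m₂) = 1`; `gcd_mul_of_coprime'`:
  `(t, L₁L₂) = (t mod L₁, L₁)(t mod L₂, L₂)`; `classWeight_mul`, `classWeightTau_mul`: the weights
  `g^{−α} ∏_{p ∣ L/g}(1 − p^{−α})/φ(L/g)` and `g^{−α} τ(L/g)/φ(L/g)` are multiplicative in `(L, g)`;
* `sum_filter_gcd_fourierChar`: `∑_{s < k, (s,k) = g} e(hs/k) = c_{k/g}(h)` (`g ∣ k`; else `0`);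
  `ramanujanSum_eq_moebius_of_coprime_natAbs`: `c_q(h) = μ(q)` for `(q, h) = 1`; Kluyver's bound
  `norm_ramanujanSum_le_sum_divisors`: `|c_q(h)| ≤ σ((q, |h|)) ≤ (q, |h|) τ((q, |h|))`.

## References

* A. J. Harper, Compositio Math. 152 (2016), §2.2 [Harper2016].
* H. L. Montgomery, R. C. Vaughan, Acta Arith. 27 (1975), §5–6 [MontgomeryVaughanActa1975].
* H. L. Montgomery, R. C. Vaughan, *Multiplicative Number Theory I* (2007), Thm 4.1 [MontgomeryVaughan2007].
-/

noncomputable section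

open Finset Real Complex
open scoped ArithmeticFunction.Moebius FourierTransform

namespace Literature.NumberTheory.Sieve

namespace SmoothArcs

/-! ### Chinese remaindering of the summation range -/

/-- **CRT reindexing.** For coprime `L₁, L₂ ≥ 1`, `m₁ ∣ L₁`, `m₂ ∣ L₂` and any `f`:
`∑_{t < L₁L₂, t ≡ r (m₁m₂)} f(t mod L₁, t mod L₂) = ∑_{t₁ < L₁, t₁ ≡ r (m₁)} ∑_{t₂ < L₂, t₂ ≡ r (m₂)} f(t₁, t₂)`
(`t ↦ (t mod L₁, t mod L₂)` is a bijection, inverse `Nat.chineseRemainder`). [folklore] -/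
theorem sum_filter_modEq_crt {M : Type*} [AddCommMonoid M] {L₁ L₂ m₁ m₂ : ℕ} (hL : L₁.Coprime L₂)
    (hL₁ : L₁ ≠ 0) (hL₂ : L₂ ≠ 0) (hm₁ : m₁ ∣ L₁) (hm₂ : m₂ ∣ L₂) (r : ℕ) (f : ℕ → ℕ → M) :
    ∑ t ∈ (Finset.range (L₁ * L₂)).filter (fun t => t ≡ r [MOD m₁ * m₂]), f (t % L₁) (t % L₂) =
      ∑ t₁ ∈ (Finset.range L₁).filter (fun t => t ≡ r [MOD m₁]),
        ∑ t₂ ∈ (Finset.range L₂).filter (fun t => t ≡ r [MOD m₂]), f t₁ t₂ := by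
  have hm : m₁.Coprime m₂ := (hL.coprime_dvd_left hm₁).coprime_dvd_right hm₂
  rw [← Finset.sum_product' (f := f)]
  refine Finset.sum_nbij' (fun t => (t % L₁, t % L₂)) (fun p => (Nat.chineseRemainder hL p.1 p.2 : ℕ))
    ?_ ?_ ?_ ?_ (fun _ _ => rfl)
  · intro t ht
    obtain ⟨-, htr⟩ := Finset.mem_filter.mp ht
    refine Finset.mem_product.mpr ⟨Finset.mem_filter.mpr ⟨?_, ?_⟩, Finset.mem_filter.mpr ⟨?_, ?_⟩⟩
    · exact Finset.mem_range.mpr (Nat.mod_lt t (Nat.pos_of_ne_zero hL₁))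
    · exact ((Nat.mod_modEq t L₁).of_dvd hm₁).trans (htr.of_mul_right m₂)
    · exact Finset.mem_range.mpr (Nat.mod_lt t (Nat.pos_of_ne_zero hL₂))
    · exact ((Nat.mod_modEq t L₂).of_dvd hm₂).trans (htr.of_mul_left m₁)
  · rintro ⟨t₁, t₂⟩ hp
    obtain ⟨h₁, h₂⟩ := Finset.mem_product.mp hp
    obtain ⟨-, h₁r⟩ := Finset.mem_filter.mp h₁
    obtain ⟨-, h₂r⟩ := Finset.mem_filter.mp h₂
    refine Finset.mem_filter.mpr ⟨Finset.mem_range.mpr (Nat.chineseRemainder_lt_mul hL t₁ t₂ hL₁ hL₂), ?_⟩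
    exact (Nat.modEq_and_modEq_iff_modEq_mul hm).mp
      ⟨((Nat.chineseRemainder hL t₁ t₂).prop.1.of_dvd hm₁).trans h₁r,
        ((Nat.chineseRemainder hL t₁ t₂).prop.2.of_dvd hm₂).trans h₂r⟩
  · intro t ht
    obtain ⟨htL, -⟩ := Finset.mem_filter.mp ht
    have h1 := Nat.chineseRemainder_modEq_unique hL (Nat.mod_modEq t L₁).symm (Nat.mod_modEq t L₂).symm
    exact (h1.symm.eq_of_lt_of_lt (Nat.chineseRemainder_lt_mul hL _ _ hL₁ hL₂) (Finset.mem_range.mp htL))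
  · rintro ⟨t₁, t₂⟩ hp
    obtain ⟨h₁, h₂⟩ := Finset.mem_product.mp hp
    obtain ⟨h₁L, -⟩ := Finset.mem_filter.mp h₁
    obtain ⟨h₂L, -⟩ := Finset.mem_filter.mp h₂
    have e₁ : ((Nat.chineseRemainder hL t₁ t₂ : ℕ)) % L₁ = t₁ % L₁ := (Nat.chineseRemainder hL t₁ t₂).prop.1
    have e₂ : ((Nat.chineseRemainder hL t₁ t₂ : ℕ)) % L₂ = t₂ % L₂ := (Nat.chineseRemainder hL t₁ t₂).prop.2
    exact Prod.ext (e₁.trans (Nat.mod_eq_of_lt (Finset.mem_range.mp h₁L)))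
      (e₂.trans (Nat.mod_eq_of_lt (Finset.mem_range.mp h₂L)))

/-- For coprime `k, m ≥ 1`: `t ↦ t mod k` is a bijection from `{t < km : t ≡ r (m)}` onto `{s < k}`, so
`∑_{t < km, t ≡ r (m)} f(t mod k) = ∑_{s < k} f(s)`. [folklore] -/
theorem sum_filter_modEq_mod_of_coprime {M : Type*} [AddCommMonoid M] {k m : ℕ} (hkm : k.Coprime m)
    (hk : k ≠ 0) (hm : m ≠ 0) (r : ℕ) (f : ℕ → M) :
    ∑ t ∈ (Finset.range (k * m)).filter (fun t => t ≡ r [MOD m]), f (t % k) = ∑ s ∈ Finset.range k, f s := by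
  have hfib : (Finset.range m).filter (fun t => t ≡ r [MOD m]) = {r % m} := by
    ext t
    simp only [Finset.mem_filter, Finset.mem_range, Finset.mem_singleton, Nat.ModEq]
    constructor
    · rintro ⟨ht, htr⟩
      rw [← htr, Nat.mod_eq_of_lt ht]
    · rintro rfl
      exact ⟨Nat.mod_lt r (Nat.pos_of_ne_zero hm), Nat.mod_mod r m⟩
  have h1 := sum_filter_modEq_crt (m₁ := 1) hkm hk hm (one_dvd k) dvd_rfl r (fun a _ => f a)
  rw [one_mul, Finset.filter_true_of_mem (fun t _ => Nat.modEq_one), hfib] at h1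
  rw [h1]
  refine Finset.sum_congr rfl fun s _ => ?_
  rw [Finset.sum_singleton]

/-- **Splitting the phase.** For coprime `k₁, k₂ ≥ 1` and `u₁ k₂ ≡ 1 (k₁)`, `u₂ k₁ ≡ 1 (k₂)`:
`e(ht/(k₁k₂)) = e(h u₁ t/k₁) e(h u₂ t/k₂)` (`u₁k₂ + u₂k₁ ≡ 1 (mod k₁k₂)`). [folklore] -/
theorem fourierChar_div_mul_eq_mul {k₁ k₂ : ℕ} (hk : k₁.Coprime k₂) (hk₁ : k₁ ≠ 0) (hk₂ : k₂ ≠ 0)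
    {u₁ u₂ : ℤ} (hu₁ : u₁ * k₂ ≡ 1 [ZMOD k₁]) (hu₂ : u₂ * k₁ ≡ 1 [ZMOD k₂]) (h : ℤ) (t : ℕ) :
    (𝐞 ((h * t : ℝ) / (k₁ * k₂ : ℕ)) : ℂ) =
      (𝐞 (((h * u₁ : ℤ) * t : ℝ) / k₁) : ℂ) * (𝐞 (((h * u₂ : ℤ) * t : ℝ) / k₂) : ℂ) := by
  -- `k₁ k₂ ∣ u₁ k₂ + u₂ k₁ - 1`
  obtain ⟨c, hc⟩ : ((k₁ : ℤ) * k₂) ∣ u₁ * k₂ + u₂ * k₁ - 1 := by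
    refine (Nat.isCoprime_iff_coprime.mpr hk).mul_dvd ?_ ?_
    · have e1 : u₁ * k₂ + u₂ * k₁ - 1 = -(1 - u₁ * k₂) + k₁ * u₂ := by ring
      rw [e1]; exact dvd_add (dvd_neg.mpr hu₁.dvd) (dvd_mul_right _ _)
    · have e2 : u₁ * k₂ + u₂ * k₁ - 1 = -(1 - u₂ * k₁) + k₂ * u₁ := by ring
      rw [e2]; exact dvd_add (dvd_neg.mpr hu₂.dvd) (dvd_mul_right _ _)
  rw [← Circle.coe_mul, ← AddChar.map_add_eq_mul]
  have hk₁' : (k₁ : ℝ) ≠ 0 := by exact_mod_cast hk₁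
  have hk₂' : (k₂ : ℝ) ≠ 0 := by exact_mod_cast hk₂
  have hc' : (u₁ : ℝ) * k₂ + u₂ * k₁ - 1 = k₁ * k₂ * c := by exact_mod_cast hc
  have key : ((h * u₁ : ℤ) * t : ℝ) / k₁ + ((h * u₂ : ℤ) * t : ℝ) / k₂ =
      (h * t : ℝ) / (k₁ * k₂ : ℕ) + ((h * t * c : ℤ) : ℝ) := by
    push_cast
    field_simp
    linear_combination (h : ℝ) * t * hc'
  rw [key, AddChar.map_add_eq_mul, Circle.coe_mul, RamanujanSum.fourierChar_intCast, mul_one]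

/-- For coprime `k₁, k₂` there are `u₁, u₂ ∈ ℤ` with `u₁k₂ ≡ 1 (mod k₁)` and `u₂k₁ ≡ 1 (mod k₂)` (Bézout),
as required by the CRT factorisations below. [folklore] -/
theorem exists_crt_units {k₁ k₂ : ℕ} (hk : k₁.Coprime k₂) :
    ∃ u₁ u₂ : ℤ, u₁ * k₂ ≡ 1 [ZMOD k₁] ∧ u₂ * k₁ ≡ 1 [ZMOD k₂] := by
  obtain ⟨a, b, hab⟩ := Nat.isCoprime_iff_coprime.mpr hk
  refine ⟨b, a, Int.modEq_iff_dvd.mpr ⟨a, ?_⟩, Int.modEq_iff_dvd.mpr ⟨b, ?_⟩⟩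
  · linear_combination (-1 : ℤ) * hab
  · linear_combination (-1 : ℤ) * hab

/-! ### Arithmetic of `L = lcm(k₁k₂, m₁m₂) = L₁ L₂` and of the weights -/

/-- `lcm(k₁, m₁)` and `lcm(k₂, m₂)` are coprime when `(k₁m₁, k₂m₂) = 1`. [folklore] -/
theorem coprime_lcm_lcm {k₁ k₂ m₁ m₂ : ℕ} (hc : (k₁ * m₁).Coprime (k₂ * m₂)) :
    (Nat.lcm k₁ m₁).Coprime (Nat.lcm k₂ m₂) :=
  (hc.coprime_dvd_left (Nat.lcm_dvd (dvd_mul_right k₁ m₁) (dvd_mul_left m₁ k₁))).coprime_dvd_right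
    (Nat.lcm_dvd (dvd_mul_right k₂ m₂) (dvd_mul_left m₂ k₂))

/-- `lcm(k₁k₂, m₁m₂) = lcm(k₁, m₁) · lcm(k₂, m₂)` when `(k₁m₁, k₂m₂) = 1`. [folklore] -/
theorem lcm_mul_mul_eq_lcm_mul_lcm {k₁ k₂ m₁ m₂ : ℕ} (hc : (k₁ * m₁).Coprime (k₂ * m₂)) :
    Nat.lcm (k₁ * k₂) (m₁ * m₂) = Nat.lcm k₁ m₁ * Nat.lcm k₂ m₂ := by
  refine Nat.dvd_antisymm ?_ ?_
  · exact Nat.lcm_dvd (mul_dvd_mul (Nat.dvd_lcm_left k₁ m₁) (Nat.dvd_lcm_left k₂ m₂))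
      (mul_dvd_mul (Nat.dvd_lcm_right k₁ m₁) (Nat.dvd_lcm_right k₂ m₂))
  · refine (coprime_lcm_lcm hc).mul_dvd_of_dvd_of_dvd ?_ ?_
    · exact Nat.lcm_dvd ((dvd_mul_right k₁ k₂).trans (Nat.dvd_lcm_left _ _))
        ((dvd_mul_right m₁ m₂).trans (Nat.dvd_lcm_right _ _))
    · exact Nat.lcm_dvd ((dvd_mul_left k₂ k₁).trans (Nat.dvd_lcm_left _ _))
        ((dvd_mul_left m₂ m₁).trans (Nat.dvd_lcm_right _ _))

/-- `gcd(t, L₁L₂) = gcd(t mod L₁, L₁) · gcd(t mod L₂, L₂)` for coprime `L₁, L₂` (`gcd(t mod L, L) = gcd(t, L)` is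
`Nat.gcd_rec` / `KloostermanQuintilinear.gcd_mod_left_eq`). [folklore] -/
theorem gcd_mul_of_coprime' {L₁ L₂ : ℕ} (hL : L₁.Coprime L₂) (t : ℕ) :
    Nat.gcd t (L₁ * L₂) = Nat.gcd (t % L₁) L₁ * Nat.gcd (t % L₂) L₂ := by
  rw [Nat.Coprime.gcd_mul t hL, ← Nat.gcd_rec L₁ t, ← Nat.gcd_rec L₂ t, Nat.gcd_comm L₁ t, Nat.gcd_comm L₂ t]

/-- The weight `g^{−α} ∏_{p ∣ L/g}(1 − p^{−α})/φ(L/g)` is multiplicative in `(L, g) = (L₁L₂, g₁g₂)`,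
`g_i ∣ L_i`, `(L₁, L₂) = 1`. [folklore] -/
theorem classWeight_mul {L₁ L₂ g₁ g₂ : ℕ} (hL : L₁.Coprime L₂) (hg₁ : g₁ ∣ L₁) (hg₂ : g₂ ∣ L₂) (α : ℝ) :
    ((g₁ * g₂ : ℕ) : ℝ) ^ (-α) * (∏ p ∈ (L₁ * L₂ / (g₁ * g₂)).primeFactors, (1 - (p : ℝ) ^ (-α))) /
        ((L₁ * L₂ / (g₁ * g₂)).totient : ℝ) =
      ((g₁ : ℝ) ^ (-α) * (∏ p ∈ (L₁ / g₁).primeFactors, (1 - (p : ℝ) ^ (-α))) / ((L₁ / g₁).totient : ℝ)) *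
      ((g₂ : ℝ) ^ (-α) * (∏ p ∈ (L₂ / g₂).primeFactors, (1 - (p : ℝ) ^ (-α))) / ((L₂ / g₂).totient : ℝ)) := by
  have hdiv : L₁ * L₂ / (g₁ * g₂) = L₁ / g₁ * (L₂ / g₂) := (Nat.div_mul_div_comm hg₁ hg₂).symm
  have hcop : (L₁ / g₁).Coprime (L₂ / g₂) :=
    (hL.coprime_dvd_left (Nat.div_dvd_of_dvd hg₁)).coprime_dvd_right (Nat.div_dvd_of_dvd hg₂)
  rw [hdiv, Nat.totient_mul hcop, hcop.primeFactors_mul, Finset.prod_union hcop.disjoint_primeFactors]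
  push_cast
  rw [Real.mul_rpow (Nat.cast_nonneg _) (Nat.cast_nonneg _)]
  ring

/-- The same for the majorant weight `g^{−α} τ(L/g)/φ(L/g)`. [folklore] -/
theorem classWeightTau_mul {L₁ L₂ g₁ g₂ : ℕ} (hL : L₁.Coprime L₂) (hg₁ : g₁ ∣ L₁) (hg₂ : g₂ ∣ L₂) (α : ℝ) :
    ((g₁ * g₂ : ℕ) : ℝ) ^ (-α) * ((L₁ * L₂ / (g₁ * g₂)).divisors.card : ℝ) /
        ((L₁ * L₂ / (g₁ * g₂)).totient : ℝ) =
      ((g₁ : ℝ) ^ (-α) * ((L₁ / g₁).divisors.card : ℝ) / ((L₁ / g₁).totient : ℝ)) *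
      ((g₂ : ℝ) ^ (-α) * ((L₂ / g₂).divisors.card : ℝ) / ((L₂ / g₂).totient : ℝ)) := by
  have hdiv : L₁ * L₂ / (g₁ * g₂) = L₁ / g₁ * (L₂ / g₂) := (Nat.div_mul_div_comm hg₁ hg₂).symm
  have hcop : (L₁ / g₁).Coprime (L₂ / g₂) :=
    (hL.coprime_dvd_left (Nat.div_dvd_of_dvd hg₁)).coprime_dvd_right (Nat.div_dvd_of_dvd hg₂)
  rw [hdiv, Nat.totient_mul hcop, Nat.Coprime.card_divisors_mul hcop]
  push_cast
  rw [Real.mul_rpow (Nat.cast_nonneg _) (Nat.cast_nonneg _)]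
  ring

/-! ### Ramanujan sums: fibres of the gcd, coprime arguments, Kluyver's bound -/

/-- `∑_{s < k, (s, k) = g} e(hs/k) = c_{k/g}(h)` if `g ∣ k` and `= 0` otherwise (`k ≥ 1`). [folklore] -/
theorem sum_filter_gcd_fourierChar {k : ℕ} (hk : k ≠ 0) (h : ℤ) (g : ℕ) :
    ∑ s ∈ (Finset.range k).filter (fun s => Nat.gcd s k = g), (𝐞 ((h * s : ℝ) / k) : ℂ) =
      if g ∣ k then ramanujanSum (k / g) h else 0 := by
  split_ifs with hg
  · have hg0 : 0 < g := Nat.pos_of_dvd_of_pos hg (Nat.pos_of_ne_zero hk)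
    have hg0' : (g : ℝ) ≠ 0 := by exact_mod_cast hg0.ne'
    have hkg0 : ((k / g : ℕ) : ℝ) ≠ 0 := by
      exact_mod_cast (Nat.div_ne_zero_iff_of_dvd hg).mpr ⟨hk, hg0.ne'⟩
    have hkg : (k : ℝ) = (g : ℝ) * ((k / g : ℕ) : ℝ) := by exact_mod_cast (Nat.mul_div_cancel' hg).symm
    rw [filter_range_gcd_eq_image hk hg, Finset.sum_image (fun x _ y _ e => (Nat.mul_right_inj hg0.ne').mp e),
      ramanujanSum]
    refine Finset.sum_congr rfl fun b _ => ?_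
    have e : (h * ((g * b : ℕ) : ℝ) : ℝ) / (k : ℝ) = (b : ℝ) * h / ((k / g : ℕ) : ℝ) := by
      rw [hkg]; push_cast; field_simp
    rw [e]
  · rw [Finset.filter_false_of_mem, Finset.sum_empty]
    intro s _ hs
    exact hg (hs ▸ Nat.gcd_dvd_right s k)

/-- `c_q(h) = μ(q)` when `(q, |h|) = 1`, `h ∈ ℤ` (Kluyver; the version for `h ∈ ℕ`, `q ≥ 1` is
`GoldbachLinnik.ramanujanSum_eq_moebius_of_coprime` in `GoldbachLinnikMajorArcMass`). [cite: MontgomeryVaughan2007, Thm 4.1] -/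
theorem ramanujanSum_eq_moebius_of_coprime_natAbs {q : ℕ} {h : ℤ} (hq : q.Coprime h.natAbs) :
    ramanujanSum q h = (μ q : ℂ) := by
  rcases Nat.eq_zero_or_pos q with rfl | hq0
  · simp
  have key : ramanujanDivisorSum h.natAbs q = μ q := by
    rw [ramanujanDivisorSum_apply, Finset.sum_eq_single (q, 1)]
    · simp
    · rintro ⟨x, y⟩ hxy hne
      obtain ⟨hxy', -⟩ := Nat.mem_divisorsAntidiagonal.mp hxy
      dsimp only at hxy' ⊢
      split_ifs with hy
      · exfalso
        apply hne
        have hy1 : y = 1 := (hq.coprime_dvd_left ⟨x, by rw [← hxy', mul_comm]⟩).eq_one_of_dvd hy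
        subst hy1
        rw [mul_one] at hxy'
        rw [hxy']
      · rw [mul_zero]
    · intro hnot
      exact absurd (Nat.mem_divisorsAntidiagonal.mpr ⟨mul_one q, hq0.ne'⟩) hnot
  rw [ramanujanSum_eq_ramanujanDivisorSum, key]

/-- The divisors of `q ≠ 0` dividing `n` are the divisors of `gcd(q, n)`. [folklore] -/
theorem divisors_filter_dvd_eq_divisors_gcd {q : ℕ} (hq : q ≠ 0) (n : ℕ) :
    (q.divisors).filter (fun d => d ∣ n) = (Nat.gcd q n).divisors := by
  ext d
  simp only [Finset.mem_filter, Nat.mem_divisors, Nat.dvd_gcd_iff]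
  exact ⟨fun ⟨⟨hdq, _⟩, hdn⟩ => ⟨⟨hdq, hdn⟩, (Nat.gcd_pos_of_pos_left n (Nat.pos_of_ne_zero hq)).ne'⟩,
    fun ⟨⟨hdq, hdn⟩, _⟩ => ⟨⟨hdq, hq⟩, hdn⟩⟩

/-- **Kluyver's bound** `|c_q(h)| ≤ ∑_{d ∣ (q, |h|)} d` (from `c_q(h) = ∑_{d ∣ (q,h)} d μ(q/d)`; the sharp
`|c_q(h)| ≤ (q, h)` via prime powers is `MatomakiMerikoski.norm_ramanujanSum_le_gcd` in
`LFunctions/IncompleteKloostermanSmooth`, with heavier imports). [cite: MontgomeryVaughan2007, Thm 4.1 eq. (4.7)] -/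
theorem norm_ramanujanSum_le_sum_divisors (q : ℕ) (h : ℤ) :
    ‖ramanujanSum q h‖ ≤ ∑ d ∈ (Nat.gcd q h.natAbs).divisors, (d : ℝ) := by
  rcases Nat.eq_zero_or_pos q with rfl | hq
  · rw [ramanujanSum_zero, norm_zero]
    exact Finset.sum_nonneg fun d _ => Nat.cast_nonneg d
  rw [ramanujanSum_eq_ramanujanDivisorSum, ramanujanDivisorSum_apply, Complex.norm_intCast,
    Nat.sum_divisorsAntidiagonal' (fun x y => (μ x : ℤ) * (if y ∣ h.natAbs then (y : ℤ) else 0)),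
    ← divisors_filter_dvd_eq_divisors_gcd hq.ne', Finset.sum_filter]
  push_cast
  refine (Finset.abs_sum_le_sum_abs _ _).trans (Finset.sum_le_sum fun d _ => ?_)
  have hμ : |(μ (q / d) : ℝ)| ≤ 1 := by exact_mod_cast ArithmeticFunction.abs_moebius_le_one
  split_ifs
  · rw [abs_mul, Nat.abs_cast]
    exact (mul_le_mul_of_nonneg_right hμ (Nat.cast_nonneg d)).trans (le_of_eq (one_mul _))
  · rw [mul_zero, abs_zero]

/-- Consequently `|c_q(h)| ≤ (q, |h|) · τ((q, |h|))`. [folklore] -/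
theorem norm_ramanujanSum_le_gcd_mul_card (q : ℕ) (h : ℤ) :
    ‖ramanujanSum q h‖ ≤ (Nat.gcd q h.natAbs : ℝ) * ((Nat.gcd q h.natAbs).divisors.card : ℝ) := by
  refine (norm_ramanujanSum_le_sum_divisors q h).trans ?_
  rw [mul_comm, ← nsmul_eq_mul]
  exact Finset.sum_le_card_nsmul _ _ _ fun d hd => by exact_mod_cast Nat.divisor_le hd

end SmoothArcs

end Literature.NumberTheory.Sieve

end
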